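import Summits.Schanuel.Schanuel.Theorems.SoloInformedAE3SharpCondEventually

/-!
# Theorem AE₃♯-2τ (η = 0): the mixed budget hypothesis of `soloMG_gelfond_input` holds
# eventually

Solo-informed Schanuel seat, session s191 (2026-08-31); ninth file (K6b) of the seat's kernel
plan for the MIXED Lemma AE₃ (`work/s188/MIXED-AE3-note.md` §3, §6).  Pure real-analysis
bookkeeping: with the SAME parameter shapes as in `SoloInformedAE32Eventually` /
`SoloInformedAE3SharpCondEventually` — `x = n^μ`, `K = ⌊n^{σ-μ}⌋`, `t = ⌊n^τ/2⌋ + 1`,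
`N = ⌊n^{1-μ+δ}⌋`, `Lg = n^{β-μ+δ}`, `V = n^ν/4` — the one hypothesis of
`soloMG_gelfond_input` that differs from those of `soloCA_gelfond_input` holds for all large
`n`:

* `soloME_natlog_le`: the dyadic-class factor `log₂ N + 1 ≤ n^δ` (`δ > 0`);
* `soloME_condD` (`h₅`, the MIXED budget of the 3-AP rigidity theorem, priced on the radical:
  `5400000 (log₂ N + 1) ((N/t)² (N/2 + Lg) + 2 N (N/t) ((N/2 + Lg)/t) + N (N/t)² log 4)
  ≤ K² V`) — the ONE place where the threshold is used, as
  `2 + β - 3μ + 4δ - 2τ < 2σ - 2μ + ν`, i.e. `ν > 2 + β - 2σ - 2τ - μ + 4δ`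
  (AE₃♯-2 needed `ν > 2 + β - 2σ - μ + 3δ` here: the derivatives now pay `2τ`).

Balancing `soloME_condD` against the transfer condition `1 + β + μ < σ + τ + ν` (`soloAW_condB`)
at `μ = (1 - σ - τ)/2` gives the AE₃♯-2τ threshold `ν > β + 3(1 - σ - τ)/2` on `1 < 3σ + τ`
(next file).

What this is NOT.  Elementary inequalities only; nothing here bears on
`Literature.Periods.SchanuelConjecture` (the seat's verdict, no path, is unchanged).
Tree files and Mathlib only; no definitions; axioms the standard three.
-/

namespace Summit.Schanuel.Schanuel.Theorems

open Filter

/-- The dyadic-class factor: eventually `log₂ ⌊n^a⌋ + 1 ≤ n^δ` (`a, δ > 0`). -/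
theorem soloME_natlog_le {a δ : ℝ} (ha0 : 0 < a) (hδ : 0 < δ) :
    ∀ᶠ n : ℕ in atTop, (Nat.log 2 ⌊(n : ℝ) ^ a⌋₊ : ℝ) + 1 ≤ (n : ℝ) ^ δ := by
  filter_upwards [soloT1_floor ha0,
    eventually_const_mul_rpow_le_rpow (half_lt_self hδ) (4 * a / δ + 1)]
    with n ⟨hn1, hN1, hNle, _w⟩ hc
  have hn0 : (0 : ℝ) < n := by linarith
  have hN1' : 1 ≤ ⌊(n : ℝ) ^ a⌋₊ := le_trans (by norm_num) hN1
  have hN0 : (0 : ℝ) < (⌊(n : ℝ) ^ a⌋₊ : ℝ) := by exact_mod_cast hN1'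
  have h1 : (Nat.log 2 ⌊(n : ℝ) ^ a⌋₊ : ℝ) ≤ Real.logb 2 (⌊(n : ℝ) ^ a⌋₊ : ℕ) :=
    Real.natLog_le_logb _ 2
  have h2 : Real.logb 2 (⌊(n : ℝ) ^ a⌋₊ : ℕ) ≤ 2 * Real.log (⌊(n : ℝ) ^ a⌋₊ : ℕ) := by
    rw [← Real.log_div_log]
    have hlog2 : (1 : ℝ) / 2 ≤ Real.log 2 := by linarith [Real.log_two_gt_d9]
    have hlogN : 0 ≤ Real.log (⌊(n : ℝ) ^ a⌋₊ : ℕ) :=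
      Real.log_nonneg (by exact_mod_cast hN1')
    calc Real.log (⌊(n : ℝ) ^ a⌋₊ : ℕ) / Real.log 2
        ≤ Real.log (⌊(n : ℝ) ^ a⌋₊ : ℕ) / (1 / 2) :=
          div_le_div_of_nonneg_left hlogN (by norm_num) hlog2
      _ = 2 * Real.log (⌊(n : ℝ) ^ a⌋₊ : ℕ) := by ring
  have h3 : Real.log (⌊(n : ℝ) ^ a⌋₊ : ℕ) ≤ a * Real.log n := by
    calc Real.log (⌊(n : ℝ) ^ a⌋₊ : ℝ) ≤ Real.log ((n : ℝ) ^ a) := Real.log_le_log hN0 hNle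
      _ = a * Real.log n := Real.log_rpow hn0 a
  have h4 : Real.log n ≤ (n : ℝ) ^ (δ / 2) / (δ / 2) :=
    Real.log_le_rpow_div hn0.le (half_pos hδ)
  have h5 : (1 : ℝ) ≤ (n : ℝ) ^ (δ / 2) := Real.one_le_rpow hn1 (half_pos hδ).le
  have h6 : (Nat.log 2 ⌊(n : ℝ) ^ a⌋₊ : ℝ) ≤ 4 * a / δ * (n : ℝ) ^ (δ / 2) := by
    have h : (Nat.log 2 ⌊(n : ℝ) ^ a⌋₊ : ℝ) ≤ 2 * (a * ((n : ℝ) ^ (δ / 2) / (δ / 2))) :=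
      calc (Nat.log 2 ⌊(n : ℝ) ^ a⌋₊ : ℝ) ≤ 2 * Real.log (⌊(n : ℝ) ^ a⌋₊ : ℕ) := h1.trans h2
        _ ≤ 2 * (a * Real.log n) := by linarith
        _ ≤ 2 * (a * ((n : ℝ) ^ (δ / 2) / (δ / 2))) :=
            mul_le_mul_of_nonneg_left (mul_le_mul_of_nonneg_left h4 ha0.le) (by norm_num)
    have e : 2 * (a * ((n : ℝ) ^ (δ / 2) / (δ / 2))) = 4 * a / δ * (n : ℝ) ^ (δ / 2) := by
      field_simp
      ring
    linarith
  have h7 : 4 * a / δ * (n : ℝ) ^ (δ / 2) + 1 ≤ (4 * a / δ + 1) * (n : ℝ) ^ (δ / 2) := by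
    nlinarith
  linarith

/-- `log 4 ≤ 3/2`. -/
theorem soloME_log_four_le : Real.log 4 ≤ 3 / 2 := by
  have h : Real.log 4 = 2 * Real.log 2 := by
    rw [show (4 : ℝ) = 2 ^ 2 by norm_num, Real.log_pow]; norm_num
  rw [h]
  linarith [Real.log_two_lt_d9]

/-- Hypothesis `h₅` of `soloMG_gelfond_input` (the MIXED budget of the 3-AP rigidity theorem,
priced on the radical), eventually — the one place where `ν > 2 + β - 2σ - 2τ - μ + 4δ` is
used (as `2 + β - 3μ + 4δ - 2τ < 2σ - 2μ + ν`). -/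
theorem soloME_condD {β σ τ ν μ δ : ℝ} (hβ : 1 ≤ β) (hμσ : μ < σ) (hτ0 : 0 ≤ τ) (hδ : 0 < δ)
    (ha0 : 0 < 1 - μ + δ) (hν : 2 + β - 3 * μ + 4 * δ - 2 * τ < 2 * σ - 2 * μ + ν) :
    ∀ᶠ n : ℕ in atTop,
      5400000 * ((Nat.log 2 ⌊(n : ℝ) ^ (1 - μ + δ)⌋₊ : ℝ) + 1) *
        (((⌊(n : ℝ) ^ (1 - μ + δ)⌋₊ : ℝ) / ((⌊(n : ℝ) ^ τ / 2⌋₊ + 1 : ℕ) : ℝ)) ^ 2 *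
            ((⌊(n : ℝ) ^ (1 - μ + δ)⌋₊ : ℝ) / 2 + (n : ℝ) ^ (β - μ + δ)) +
          2 * (⌊(n : ℝ) ^ (1 - μ + δ)⌋₊ : ℝ) *
            ((⌊(n : ℝ) ^ (1 - μ + δ)⌋₊ : ℝ) / ((⌊(n : ℝ) ^ τ / 2⌋₊ + 1 : ℕ) : ℝ)) *
            (((⌊(n : ℝ) ^ (1 - μ + δ)⌋₊ : ℝ) / 2 + (n : ℝ) ^ (β - μ + δ)) /
              ((⌊(n : ℝ) ^ τ / 2⌋₊ + 1 : ℕ) : ℝ)) +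
          (⌊(n : ℝ) ^ (1 - μ + δ)⌋₊ : ℝ) *
            ((⌊(n : ℝ) ^ (1 - μ + δ)⌋₊ : ℝ) / ((⌊(n : ℝ) ^ τ / 2⌋₊ + 1 : ℕ) : ℝ)) ^ 2 *
            Real.log 4) ≤
      (⌊(n : ℝ) ^ (σ - μ)⌋₊ : ℝ) ^ 2 * ((n : ℝ) ^ ν / 4) := by
  filter_upwards [soloT1_floor (sub_pos.mpr hμσ), soloT1_floor ha0, soloAV_tfloor hτ0,
    soloME_natlog_le ha0 hδ, eventually_const_mul_rpow_le_rpow hν (5400000 * 24 * 16)]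
    with n ⟨hn1, _w2, _w3, hKge⟩ ⟨_w4, _w5, hNle, _w6⟩ ⟨_w7, _w8, htge, _w9⟩ hlog hc
  have hn0 : (0 : ℝ) < n := by linarith
  set J : ℝ := (Nat.log 2 ⌊(n : ℝ) ^ (1 - μ + δ)⌋₊ : ℝ) + 1 with hJdef
  set K : ℝ := (⌊(n : ℝ) ^ (σ - μ)⌋₊ : ℝ) with hKdef
  set N : ℝ := (⌊(n : ℝ) ^ (1 - μ + δ)⌋₊ : ℝ) with hNdef
  set T : ℝ := ((⌊(n : ℝ) ^ τ / 2⌋₊ + 1 : ℕ) : ℝ) with hTdef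
  set P : ℝ := (n : ℝ) ^ (1 - μ + δ) with hPdef
  set Lg : ℝ := (n : ℝ) ^ (β - μ + δ) with hLgdef
  have hN0 : 0 ≤ N := by rw [hNdef]; exact Nat.cast_nonneg _
  have hT0 : 0 < T := by rw [hTdef]; positivity
  have hJ0 : 0 ≤ J := by rw [hJdef]; positivity
  have hP0 : 0 ≤ P := by rw [hPdef]; positivity
  have hLg0 : 0 ≤ Lg := by rw [hLgdef]; positivity
  have hPLg : P ≤ Lg := Real.rpow_le_rpow_of_exponent_le hn1 (by linarith)
  have hNLg : N ≤ Lg := hNle.trans hPLg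
  -- `N/t ≤ 2 n^{1-μ+δ-τ}` and `(N/2 + Lg)/t ≤ 3 n^{β-μ+δ-τ}`
  have hDa0 : 0 ≤ (n : ℝ) ^ (1 - μ + δ - τ) := by positivity
  have hLa0 : 0 ≤ (n : ℝ) ^ (β - μ + δ - τ) := by positivity
  have hτP : (n : ℝ) ^ τ * (n : ℝ) ^ (1 - μ + δ - τ) = P := by
    rw [hPdef, ← Real.rpow_add hn0]; ring_nf
  have hτLg : (n : ℝ) ^ τ * (n : ℝ) ^ (β - μ + δ - τ) = Lg := by
    rw [hLgdef, ← Real.rpow_add hn0]; ring_nf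
  have hD : N / T ≤ 2 * (n : ℝ) ^ (1 - μ + δ - τ) := by
    rw [div_le_iff₀ hT0]
    calc N ≤ P := hNle
      _ = 2 * (n : ℝ) ^ (1 - μ + δ - τ) * ((n : ℝ) ^ τ / 2) := by rw [← hτP]; ring
      _ ≤ 2 * (n : ℝ) ^ (1 - μ + δ - τ) * T := mul_le_mul_of_nonneg_left htge (by positivity)
  have hD0 : 0 ≤ N / T := by positivity
  have hY : N / 2 + Lg ≤ 3 / 2 * Lg := by linarith
  have hY0 : 0 ≤ N / 2 + Lg := by positivity
  have hL : (N / 2 + Lg) / T ≤ 3 * (n : ℝ) ^ (β - μ + δ - τ) := by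
    rw [div_le_iff₀ hT0]
    calc N / 2 + Lg ≤ 3 / 2 * Lg := hY
      _ = 3 * (n : ℝ) ^ (β - μ + δ - τ) * ((n : ℝ) ^ τ / 2) := by rw [← hτLg]; ring
      _ ≤ 3 * (n : ℝ) ^ (β - μ + δ - τ) * T := mul_le_mul_of_nonneg_left htge (by positivity)
  -- exponent identities, `E = 2 + β - 3μ + 3δ - 2τ`
  have e1 : ((n : ℝ) ^ (1 - μ + δ - τ)) ^ 2 * Lg = (n : ℝ) ^ (2 + β - 3 * μ + 3 * δ - 2 * τ) := by
    rw [hLgdef, soloTT_rpow_pow hn0.le, ← Real.rpow_add hn0]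
    congr 1; push_cast; ring
  have e2 : P * (n : ℝ) ^ (1 - μ + δ - τ) * (n : ℝ) ^ (β - μ + δ - τ) =
      (n : ℝ) ^ (2 + β - 3 * μ + 3 * δ - 2 * τ) := by
    rw [hPdef, ← Real.rpow_add hn0, ← Real.rpow_add hn0]
    congr 1; ring
  have e3 : P * ((n : ℝ) ^ (1 - μ + δ - τ)) ^ 2 ≤
      (n : ℝ) ^ (2 + β - 3 * μ + 3 * δ - 2 * τ) := by
    rw [hPdef, soloTT_rpow_pow hn0.le, ← Real.rpow_add hn0]
    exact Real.rpow_le_rpow_of_exponent_le hn1 (by push_cast; linarith)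
  have e4 : (n : ℝ) ^ δ * (n : ℝ) ^ (2 + β - 3 * μ + 3 * δ - 2 * τ) =
      (n : ℝ) ^ (2 + β - 3 * μ + 4 * δ - 2 * τ) := by
    rw [← Real.rpow_add hn0]; congr 1; ring
  have hE0 : 0 ≤ (n : ℝ) ^ (2 + β - 3 * μ + 3 * δ - 2 * τ) := by positivity
  -- the three terms
  have hD2 : (N / T) ^ 2 ≤ (2 * (n : ℝ) ^ (1 - μ + δ - τ)) ^ 2 := pow_le_pow_left₀ hD0 hD 2
  have t1 : (N / T) ^ 2 * (N / 2 + Lg) ≤ 6 * (n : ℝ) ^ (2 + β - 3 * μ + 3 * δ - 2 * τ) :=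
    calc (N / T) ^ 2 * (N / 2 + Lg) ≤ (2 * (n : ℝ) ^ (1 - μ + δ - τ)) ^ 2 * (3 / 2 * Lg) :=
          mul_le_mul hD2 hY hY0 (by positivity)
      _ = 6 * (((n : ℝ) ^ (1 - μ + δ - τ)) ^ 2 * Lg) := by ring
      _ = 6 * (n : ℝ) ^ (2 + β - 3 * μ + 3 * δ - 2 * τ) := by rw [e1]
  have t2 : 2 * N * (N / T) * ((N / 2 + Lg) / T) ≤
      12 * (n : ℝ) ^ (2 + β - 3 * μ + 3 * δ - 2 * τ) := by
    have ha : 2 * N ≤ 2 * P := by linarith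
    have hb : 2 * N * (N / T) ≤ 2 * P * (2 * (n : ℝ) ^ (1 - μ + δ - τ)) :=
      mul_le_mul ha hD hD0 (by positivity)
    calc 2 * N * (N / T) * ((N / 2 + Lg) / T)
        ≤ 2 * P * (2 * (n : ℝ) ^ (1 - μ + δ - τ)) * (3 * (n : ℝ) ^ (β - μ + δ - τ)) :=
          mul_le_mul hb hL (by positivity) (by positivity)
      _ = 12 * (P * (n : ℝ) ^ (1 - μ + δ - τ) * (n : ℝ) ^ (β - μ + δ - τ)) := by ring
      _ = 12 * (n : ℝ) ^ (2 + β - 3 * μ + 3 * δ - 2 * τ) := by rw [e2]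
  have t3 : N * (N / T) ^ 2 * Real.log 4 ≤ 6 * (n : ℝ) ^ (2 + β - 3 * μ + 3 * δ - 2 * τ) := by
    have hlog4 : 0 ≤ Real.log 4 := Real.log_nonneg (by norm_num)
    calc N * (N / T) ^ 2 * Real.log 4 ≤ P * (2 * (n : ℝ) ^ (1 - μ + δ - τ)) ^ 2 * (3 / 2) :=
          mul_le_mul (mul_le_mul hNle hD2 (by positivity) hP0) soloME_log_four_le hlog4
            (by positivity)
      _ = 6 * (P * ((n : ℝ) ^ (1 - μ + δ - τ)) ^ 2) := by ring
      _ ≤ 6 * (n : ℝ) ^ (2 + β - 3 * μ + 3 * δ - 2 * τ) := by linarith [e3]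
  have hB : (N / T) ^ 2 * (N / 2 + Lg) + 2 * N * (N / T) * ((N / 2 + Lg) / T) +
      N * (N / T) ^ 2 * Real.log 4 ≤ 24 * (n : ℝ) ^ (2 + β - 3 * μ + 3 * δ - 2 * τ) := by
    linarith
  have hB0 : 0 ≤ (N / T) ^ 2 * (N / 2 + Lg) + 2 * N * (N / T) * ((N / 2 + Lg) / T) +
      N * (N / T) ^ 2 * Real.log 4 := by
    have hlog4 : 0 ≤ Real.log 4 := Real.log_nonneg (by norm_num)
    positivity
  -- the left side is at most `5400000 · 24 · n^{2+β-3μ+4δ-2τ}`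
  have hLHS : 5400000 * J * ((N / T) ^ 2 * (N / 2 + Lg) + 2 * N * (N / T) * ((N / 2 + Lg) / T)
      + N * (N / T) ^ 2 * Real.log 4) ≤
      5400000 * 24 * (n : ℝ) ^ (2 + β - 3 * μ + 4 * δ - 2 * τ) := by
    calc 5400000 * J * _ ≤ 5400000 * (n : ℝ) ^ δ *
          (24 * (n : ℝ) ^ (2 + β - 3 * μ + 3 * δ - 2 * τ)) :=
          mul_le_mul (mul_le_mul_of_nonneg_left hlog (by norm_num)) hB hB0 (by positivity)
      _ = 5400000 * 24 * ((n : ℝ) ^ δ * (n : ℝ) ^ (2 + β - 3 * μ + 3 * δ - 2 * τ)) := by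
          ring
      _ = 5400000 * 24 * (n : ℝ) ^ (2 + β - 3 * μ + 4 * δ - 2 * τ) := by rw [e4]
  -- the right side is at least `n^{2σ-2μ+ν} / 16`
  have hR : (n : ℝ) ^ (2 * σ - 2 * μ + ν) / 16 ≤ K ^ 2 * ((n : ℝ) ^ ν / 4) := by
    have hK2 : ((n : ℝ) ^ (σ - μ) / 2) ^ 2 ≤ K ^ 2 := pow_le_pow_left₀ (by positivity) hKge 2
    have e5 : (n : ℝ) ^ (2 * σ - 2 * μ + ν) = ((n : ℝ) ^ (σ - μ)) ^ 2 * (n : ℝ) ^ ν := by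
      rw [soloTT_rpow_pow hn0.le, ← Real.rpow_add hn0]
      congr 1
      push_cast
      ring
    rw [e5]
    have hν0 : 0 ≤ (n : ℝ) ^ ν / 4 := by positivity
    calc ((n : ℝ) ^ (σ - μ)) ^ 2 * (n : ℝ) ^ ν / 16
        = ((n : ℝ) ^ (σ - μ) / 2) ^ 2 * ((n : ℝ) ^ ν / 4) := by ring
      _ ≤ K ^ 2 * ((n : ℝ) ^ ν / 4) := mul_le_mul_of_nonneg_right hK2 hν0
  linarith [hc]

end Summit.Schanuel.Schanuel.Theorems
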